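import Summits.CriticalPhenomena.PercolationContinuityZ3.Theorems.FK.PressureMeanFieldBound
import HarnessLib

/-!
# THE GIBBS VARIATIONAL PRINCIPLE IN FINITE VOLUME: `log Z = max_p [⟨−βH⟩_p + S(p)]`, attained exactly at the
# Gibbs distribution, with the deficit of any trial state equal to its relative entropy
# (Friedli–Velenik 2017, §6.9 (variational principle), Lemma 6.74ff; Ruelle 1969, §2.6; Griffiths 1972, §V.C)

Claimed R42 (8)(c) in the cell INBOX at 2026-08-29T04:59:39Z by fkp-10a gen 358 (NEW CLAIM #3 of the gen), addressed to coordinator fk-4 gen 292 (seated 04:05Z 2026-08-29 by l.8710; R166 / R167 in force); lineage row FO-10a-g358m (self-suggested), package g358-meanfield, label GV-A.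
Helper file of the `fk-continuity` build cell (bschramm lane; `--supports stmt-CriticalPhenomena-4575`); builds on
p205010 (kernel theorem, internal audit signed; external expert review pending). No definitions, no named facts, no
sorries; standard axioms. UNCONDITIONAL (finite probability; the Ising instantiation holds on any locally finite
graph with any boundary condition and all real `β`, `h`).

`PressureMeanFieldBound` used the INEQUALITY `Σᵢ pᵢaᵢ − Σᵢ pᵢ log pᵢ ≤ log Σᵢ e^{aᵢ}`; this file completes it to the
variational PRINCIPLE. With the Gibbs weights `gᵢ = e^{aᵢ}/Σⱼ e^{aⱼ}`:

* `sum_gibbsWeight_eq_one`, **`log_sum_exp_eq_gibbs`** — `log Σᵢ e^{aᵢ} = Σᵢ gᵢ aᵢ − Σᵢ gᵢ log gᵢ`: the Gibbs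
  distribution ATTAINS the bound (energy plus entropy);
* **`log_sum_exp_sub_eq_sum_mul_log_div`** — for every probability vector `p`: the deficit
  `log Σ e^{aᵢ} − (Σ pᵢaᵢ − Σ pᵢ log pᵢ) = Σᵢ pᵢ log (pᵢ/gᵢ)` is the RELATIVE ENTROPY of `p` w.r.t. `g`;
* **`sum_mul_log_div_nonneg`**, **`sum_mul_log_div_eq_zero_iff`** — Gibbs' inequality `Σ pᵢ log(pᵢ/gᵢ) ≥ 0` with
  equality iff `p = g` (for `g > 0`); hence **`sum_mul_sub_sum_mul_log_eq_log_sum_exp_iff`** — a trial state attains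
  `log Σ e^{aᵢ}` iff it IS the Gibbs distribution (uniqueness of the maximiser);
* `isGreatest_log_sum_exp` — `log Σ e^{aᵢ}` is the greatest value of `Σ pᵢaᵢ − Σ pᵢ log pᵢ` over probability vectors;
* Ising instantiation (any graph, volume, b.c., real `β`, `h`): **`log_isingPartitionFunction_eq_energy_add_entropy`** —
  `log Z^{bc}_{Λ;β,h} = ⟨−βH⟩^{bc}_{Λ;β,h} − Σ_τ p_τ log p_τ` with `p_τ = w(τ)/Z` the finite-volume Gibbs probabilities, and
  **`isGreatest_log_isingPartitionFunction`** — `log Z^{bc}_Λ = max_p [Σ_τ p_τ(−βH(τ)) − Σ_τ p_τ log p_τ]` over all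
  probability vectors `p` on `Λ → {±1}`.

## References

* S. Friedli, Y. Velenik, *Statistical Mechanics of Lattice Systems*, CUP (2017), §6.9 (the variational principle;
  finite-volume version and relative entropy). [FriedliVelenik2017]
* D. Ruelle, *Statistical Mechanics: Rigorous Results*, Benjamin (1969), §2.6. [Ruelle1969]
* R. B. Griffiths, in Phase Transitions and Critical Phenomena 1 (1972), §V.C. [Griffiths1972]
-/

noncomputable section

namespace Summit.CriticalPhenomena.PercolationContinuityZ3.Theorems.FK

namespace IsingPressure

open MeasureTheory Filter Topology Finset Set
open Literature.Probability.LatticeModels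

variable {d : ℕ}

/-! ### Gibbs' inequality for the relative entropy on a finite set -/

/-- **Gibbs' inequality**: for probability vectors `p, g` on a finite type with `g > 0`,
`0 ≤ Σᵢ pᵢ log (pᵢ / gᵢ)` (`log x ≤ x − 1` at `x = gᵢ/pᵢ`). [cite: FriedliVelenik2017, §6.9; Griffiths1972, §V.C] -/
theorem sum_mul_log_div_nonneg {ι : Type*} [Fintype ι] (p g : ι → ℝ) (hp0 : ∀ i, 0 ≤ p i) (hp1 : ∑ i, p i = 1)
    (hg0 : ∀ i, 0 < g i) (hg1 : ∑ i, g i = 1) :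
    0 ≤ ∑ i, p i * Real.log (p i / g i) := by
  -- `p i log (g i / p i) ≤ g i - p i` termwise (trivial when `p i = 0`)
  have key : ∀ i, -(p i * Real.log (p i / g i)) ≤ g i - p i := by
    intro i
    rcases (hp0 i).eq_or_lt with h0 | hpos
    · rw [← h0]; simp [(hg0 i).le]
    · have hx : 0 < g i / p i := div_pos (hg0 i) hpos
      have h1 := Real.log_le_sub_one_of_pos hx
      have e : Real.log (p i / g i) = -Real.log (g i / p i) := by
        rw [Real.log_div hpos.ne' (hg0 i).ne', Real.log_div (hg0 i).ne' hpos.ne']; ring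
      rw [e, mul_neg, neg_neg]
      calc p i * Real.log (g i / p i) ≤ p i * (g i / p i - 1) := mul_le_mul_of_nonneg_left h1 hpos.le
        _ = g i - p i := by field_simp
  have hsum : -(∑ i, p i * Real.log (p i / g i)) ≤ ∑ i, (g i - p i) := by
    rw [← sum_neg_distrib]; exact sum_le_sum fun i _ => key i
  rw [sum_sub_distrib, hg1, hp1, sub_self] at hsum
  linarith

/-- **Equality in Gibbs' inequality holds iff `p = g`** (`g > 0`): `Σᵢ pᵢ log (pᵢ/gᵢ) = 0 ↔ p = g`
(`log x = x − 1` only at `x = 1`). [cite: FriedliVelenik2017, §6.9] -/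
theorem sum_mul_log_div_eq_zero_iff {ι : Type*} [Fintype ι] (p g : ι → ℝ) (hp0 : ∀ i, 0 ≤ p i) (hp1 : ∑ i, p i = 1)
    (hg0 : ∀ i, 0 < g i) (hg1 : ∑ i, g i = 1) :
    ∑ i, p i * Real.log (p i / g i) = 0 ↔ p = g := by
  constructor
  · intro hzero
    -- termwise slack `s i = (g i - p i) + p i log (p i / g i) ≥ 0` sums to `0`, so each vanishes
    have key : ∀ i, 0 ≤ (g i - p i) + p i * Real.log (p i / g i) := by
      intro i
      rcases (hp0 i).eq_or_lt with h0 | hpos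
      · rw [← h0]; simp [(hg0 i).le]
      · have hx : 0 < g i / p i := div_pos (hg0 i) hpos
        have h1 := Real.log_le_sub_one_of_pos hx
        have e : Real.log (p i / g i) = -Real.log (g i / p i) := by
          rw [Real.log_div hpos.ne' (hg0 i).ne', Real.log_div (hg0 i).ne' hpos.ne']; ring
        rw [e]
        have : p i * Real.log (g i / p i) ≤ g i - p i := by
          calc p i * Real.log (g i / p i) ≤ p i * (g i / p i - 1) := mul_le_mul_of_nonneg_left h1 hpos.le
            _ = g i - p i := by field_simp
        linarith
    have hsum : ∑ i, ((g i - p i) + p i * Real.log (p i / g i)) = 0 := by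
      rw [sum_add_distrib, sum_sub_distrib, hg1, hp1, hzero]; ring
    have hterm : ∀ i, (g i - p i) + p i * Real.log (p i / g i) = 0 := fun i =>
      (sum_eq_zero_iff_of_nonneg (fun j _ => key j)).1 hsum i (mem_univ i)
    -- if some `p i = 0` then `g i = 0`, impossible; so `p > 0`, then `log (g/p) = g/p − 1` forces `g = p`
    funext i
    rcases (hp0 i).eq_or_lt with h0 | hpos
    · have := hterm i; rw [← h0] at this; simp at this; exact absurd this (hg0 i).ne'
    · have hx : 0 < g i / p i := div_pos (hg0 i) hpos
      have e : Real.log (p i / g i) = -Real.log (g i / p i) := by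
        rw [Real.log_div hpos.ne' (hg0 i).ne', Real.log_div (hg0 i).ne' hpos.ne']; ring
      have h1 : Real.log (g i / p i) = g i / p i - 1 := by
        apply le_antisymm (Real.log_le_sub_one_of_pos hx)
        have := hterm i
        rw [e] at this
        have h2 : p i * Real.log (g i / p i) = g i - p i := by linarith
        have h3 : Real.log (g i / p i) = (g i - p i) / p i := by
          field_simp; linarith
        rw [h3]; apply le_of_eq; field_simp
      -- `log x = x - 1` forces `x = 1`
      have hx1 : g i / p i = 1 := by
        by_contra hne
        have := Real.log_lt_sub_one_of_pos hx hne
        linarith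
      field_simp at hx1; linarith
  · rintro rfl
    exact sum_eq_zero fun i _ => by rw [div_self (hg0 i).ne', Real.log_one, mul_zero]

/-! ### The Gibbs distribution attains the variational bound; the deficit is the relative entropy -/

/-- The Gibbs weights `e^{aᵢ}/Σⱼ e^{aⱼ}` sum to `1`. [folklore] -/
theorem sum_gibbsWeight_eq_one {ι : Type*} [Fintype ι] [Nonempty ι] (a : ι → ℝ) :
    ∑ i, Real.exp (a i) / ∑ j, Real.exp (a j) = 1 := by
  have hZ : 0 < ∑ j, Real.exp (a j) := sum_pos (fun j _ => Real.exp_pos _) univ_nonempty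
  rw [← sum_div, div_self hZ.ne']

/-- **The Gibbs distribution attains the variational bound**: with `gᵢ = e^{aᵢ}/Z`, `Z = Σⱼ e^{aⱼ}`,
`Σᵢ gᵢ aᵢ − Σᵢ gᵢ log gᵢ = log Z` (energy plus entropy of the Gibbs state is the log-partition function).
[cite: FriedliVelenik2017, §6.9; Ruelle1969, §2.6] -/
theorem log_sum_exp_eq_gibbs {ι : Type*} [Fintype ι] [Nonempty ι] (a : ι → ℝ) :
    ∑ i, (Real.exp (a i) / ∑ j, Real.exp (a j)) * a i -
        ∑ i, (Real.exp (a i) / ∑ j, Real.exp (a j)) * Real.log (Real.exp (a i) / ∑ j, Real.exp (a j)) =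
      Real.log (∑ j, Real.exp (a j)) := by
  have hZ : 0 < ∑ j, Real.exp (a j) := sum_pos (fun j _ => Real.exp_pos _) univ_nonempty
  have h1 := sum_gibbsWeight_eq_one a
  have hlog : ∀ i, Real.log (Real.exp (a i) / ∑ j, Real.exp (a j)) = a i - Real.log (∑ j, Real.exp (a j)) :=
    fun i => by rw [Real.log_div (Real.exp_pos _).ne' hZ.ne', Real.log_exp]
  simp_rw [hlog, mul_sub]
  rw [sum_sub_distrib, ← sum_mul, h1, one_mul]
  ring

/-- **The deficit of a trial state is its relative entropy**: for every probability vector `p`,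
`log Σᵢ e^{aᵢ} − (Σᵢ pᵢ aᵢ − Σᵢ pᵢ log pᵢ) = Σᵢ pᵢ log (pᵢ / gᵢ)` with `gᵢ = e^{aᵢ}/Σⱼ e^{aⱼ}`.
[cite: FriedliVelenik2017, §6.9] -/
theorem log_sum_exp_sub_eq_sum_mul_log_div {ι : Type*} [Fintype ι] [Nonempty ι] (p a : ι → ℝ)
    (hp1 : ∑ i, p i = 1) :
    Real.log (∑ j, Real.exp (a j)) - (∑ i, p i * a i - ∑ i, p i * Real.log (p i)) =
      ∑ i, p i * Real.log (p i / (Real.exp (a i) / ∑ j, Real.exp (a j))) := by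
  have hZ : 0 < ∑ j, Real.exp (a j) := sum_pos (fun j _ => Real.exp_pos _) univ_nonempty
  -- `p i log (p i / g i) = p i log p i - p i a i + p i log Z`, also when `p i = 0`
  have key : ∀ i, p i * Real.log (p i / (Real.exp (a i) / ∑ j, Real.exp (a j))) =
      p i * Real.log (p i) - p i * a i + p i * Real.log (∑ j, Real.exp (a j)) := by
    intro i
    by_cases h0 : p i = 0
    · simp [h0]
    · rw [Real.log_div h0 (div_pos (Real.exp_pos _) hZ).ne', Real.log_div (Real.exp_pos _).ne' hZ.ne', Real.log_exp]
      ring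
  simp_rw [key]
  rw [sum_add_distrib, sum_sub_distrib, ← sum_mul, hp1, one_mul]
  ring

/-- **THE VARIATIONAL PRINCIPLE WITH UNIQUENESS**: for a probability vector `p`,
`Σᵢ pᵢ aᵢ − Σᵢ pᵢ log pᵢ = log Σᵢ e^{aᵢ}` **iff** `p` is the Gibbs distribution `e^{aᵢ}/Σⱼ e^{aⱼ}`.
[cite: FriedliVelenik2017, §6.9; Ruelle1969, §2.6] -/
theorem sum_mul_sub_sum_mul_log_eq_log_sum_exp_iff {ι : Type*} [Fintype ι] [Nonempty ι] (p a : ι → ℝ)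
    (hp0 : ∀ i, 0 ≤ p i) (hp1 : ∑ i, p i = 1) :
    ∑ i, p i * a i - ∑ i, p i * Real.log (p i) = Real.log (∑ j, Real.exp (a j)) ↔
      p = fun i => Real.exp (a i) / ∑ j, Real.exp (a j) := by
  have hZ : 0 < ∑ j, Real.exp (a j) := sum_pos (fun j _ => Real.exp_pos _) univ_nonempty
  have hdef := log_sum_exp_sub_eq_sum_mul_log_div p a hp1
  have hiff := sum_mul_log_div_eq_zero_iff p (fun i => Real.exp (a i) / ∑ j, Real.exp (a j)) hp0 hp1
    (fun i => div_pos (Real.exp_pos _) hZ) (sum_gibbsWeight_eq_one a)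
  rw [← hiff, ← hdef]
  constructor
  · intro h; rw [h, sub_self]
  · intro h; linarith

/-- **`log Σ e^{aᵢ}` is the GREATEST value of `Σ pᵢ aᵢ − Σ pᵢ log pᵢ` over probability vectors.**
[cite: FriedliVelenik2017, §6.9; Ruelle1969, §2.6] -/
theorem isGreatest_log_sum_exp {ι : Type*} [Fintype ι] [Nonempty ι] (a : ι → ℝ) :
    IsGreatest {v : ℝ | ∃ p : ι → ℝ, (∀ i, 0 ≤ p i) ∧ ∑ i, p i = 1 ∧ v = ∑ i, p i * a i - ∑ i, p i * Real.log (p i)}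
      (Real.log (∑ j, Real.exp (a j))) := by
  have hZ : 0 < ∑ j, Real.exp (a j) := sum_pos (fun j _ => Real.exp_pos _) univ_nonempty
  refine ⟨⟨fun i => Real.exp (a i) / ∑ j, Real.exp (a j), fun i => (div_pos (Real.exp_pos _) hZ).le,
    sum_gibbsWeight_eq_one a, (log_sum_exp_eq_gibbs a).symm⟩, ?_⟩
  rintro v ⟨p, hp0, hp1, rfl⟩
  exact sum_mul_sub_sum_mul_log_le_log_sum_exp p a hp0 hp1

/-! ### The Ising instantiation -/

section FiniteVolume

variable {V : Type*} (G : SimpleGraph V) [DecidableEq V] [G.LocallyFinite]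

/-- **`log Z^{bc}_{Λ;β,h} = ⟨−βH⟩^{bc}_{Λ;β,h} − Σ_τ p_τ log p_τ`** with `p_τ = w(τ)/Z` the finite-volume Gibbs
probabilities: the log-partition function is the mean energy term plus the Gibbs entropy (every graph, volume,
boundary condition, real `β`, `h`). [cite: FriedliVelenik2017, §6.9 and §3.2.1; Ruelle1969, §2.6] -/
theorem log_isingPartitionFunction_eq_energy_add_entropy (Λ : Finset V) (β h : ℝ) (bc : BoundaryCondition V) :
    Real.log (isingPartitionFunction G Λ β h bc) =
      isingExpect G Λ β h bc (fun σ => -β * isingHamiltonian G Λ h bc σ) -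
        ∑ τ : Λ → ℤˣ, (isingWeight G Λ β h bc τ / isingPartitionFunction G Λ β h bc) *
          Real.log (isingWeight G Λ β h bc τ / isingPartitionFunction G Λ β h bc) := by
  have inst : Nonempty (Λ → ℤˣ) := ⟨fun _ => 1⟩
  have hE : isingExpect G Λ β h bc (fun σ => -β * isingHamiltonian G Λ h bc σ) =
      ∑ τ : Λ → ℤˣ, (isingWeight G Λ β h bc τ / isingPartitionFunction G Λ β h bc) *
        (-β * isingHamiltonian G Λ h bc (glue Λ τ bc)) := by
    rw [isingExpect, integral_isingMeasure G Λ β h bc ((measurable_isingHamiltonian G Λ h bc).const_mul _),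
      Finset.sum_div]
    exact sum_congr rfl fun τ _ => by ring
  rw [hE]
  have h := log_sum_exp_eq_gibbs (fun τ : Λ → ℤˣ => -β * isingHamiltonian G Λ h bc (glue Λ τ bc))
  simp only [← isingPartitionFunction_eq_sum_exp] at h
  rw [← h]
  rfl

/-- **THE GIBBS VARIATIONAL PRINCIPLE FOR THE FINITE-VOLUME ISING MODEL**: `log Z^{bc}_{Λ;β,h}` is the greatest
value of `Σ_τ p_τ (−βH(glue τ)) − Σ_τ p_τ log p_τ` over all probability vectors `p` on `Λ → {±1}`, attained at (and,
by `sum_mul_sub_sum_mul_log_eq_log_sum_exp_iff`, only at) the Gibbs distribution.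
[cite: FriedliVelenik2017, §6.9; Ruelle1969, §2.6; Griffiths1972, §V.C] -/
theorem isGreatest_log_isingPartitionFunction (Λ : Finset V) (β h : ℝ) (bc : BoundaryCondition V) :
    IsGreatest {v : ℝ | ∃ p : (Λ → ℤˣ) → ℝ, (∀ τ, 0 ≤ p τ) ∧ ∑ τ, p τ = 1 ∧
        v = ∑ τ, p τ * (-β * isingHamiltonian G Λ h bc (glue Λ τ bc)) - ∑ τ, p τ * Real.log (p τ)}
      (Real.log (isingPartitionFunction G Λ β h bc)) := by
  have inst : Nonempty (Λ → ℤˣ) := ⟨fun _ => 1⟩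
  rw [isingPartitionFunction_eq_sum_exp]
  exact isGreatest_log_sum_exp _

/-- **Uniqueness of the maximiser for the Ising model**: a probability vector `p` on `Λ → {±1}` attains
`log Z^{bc}_{Λ;β,h}` iff `p_τ = e^{−βH(glue τ)}/Z` is the finite-volume Gibbs distribution. [cite: FriedliVelenik2017, §6.9] -/
theorem energy_add_entropy_eq_log_isingPartitionFunction_iff (Λ : Finset V) (β h : ℝ) (bc : BoundaryCondition V)
    (p : (Λ → ℤˣ) → ℝ) (hp0 : ∀ τ, 0 ≤ p τ) (hp1 : ∑ τ, p τ = 1) :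
    ∑ τ, p τ * (-β * isingHamiltonian G Λ h bc (glue Λ τ bc)) - ∑ τ, p τ * Real.log (p τ) =
        Real.log (isingPartitionFunction G Λ β h bc) ↔
      p = fun τ => isingWeight G Λ β h bc τ / isingPartitionFunction G Λ β h bc := by
  have inst : Nonempty (Λ → ℤˣ) := ⟨fun _ => 1⟩
  rw [isingPartitionFunction_eq_sum_exp]
  exact sum_mul_sub_sum_mul_log_eq_log_sum_exp_iff p _ hp0 hp1

end FiniteVolume

end IsingPressure

end Summit.CriticalPhenomena.PercolationContinuityZ3.Theorems.FK

end
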